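import Mathlib
import Summits.ValiantsHypothesis.ValiantsHypothesis.Theorems.FifoMatchingNNDivisionHardUnsaturatedTier
import Summits.ValiantsHypothesis.ValiantsHypothesis.Theorems.FifoMatchingNNDivisionHardStackPowersQueue
import Summits.ValiantsHypothesis.ValiantsHypothesis.Theses.FifoMatching
import HarnessLib

/-!
# Route FifoMatching — crux `NNDivisionHard` (stmt-ValiantsHypothesis-21181): the residual of record is its cheap,
# torus-homogeneous, hyper-degree, unsaturated **and NON-GENERIC** tier, by name

Composition of the landed localisation `UnsaturatedTier.nnDivisionHard_iff_unsaturatedTier` (21181 ⟺ every cheap,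
torus-homogeneous, hyper-degree, unsaturated cofactor is beaten) with the new engine
`StackPowersQueue.generic_not_certificate_qp` (`Theorems/FifoMatchingNNDivisionHardStackPowersQueue.lean`: a cofactor with a
UNIQUE maximal monomial in the pinned rainbow direction `prWeight n ⌊(n+2)/3⌋ = (n+1)·𝟙_R + 𝟙_{pins}` is never a
quasi-polynomial certificate — its certificate would read the face `x^{pins} · NN_{⌊(n+2)/3⌋}`):

* ★ `nnDivisionHard_iff_unsaturatedNonGenericTier` — **`NNDivisionHard` ⟺ for every `c`, eventually in `n`, every nonzero
  cofactor `h` which (i) is torus-homogeneous, (ii) has total degree `> 2^⌊n^{1/8}⌋`, (iii) is cheap, (iv) is unsaturated,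
  and (v) is NON-GENERIC in the pinned rainbow direction — every monomial of `h` is weakly dominated in `w`-weight by another
  monomial of `h` (the `w`-top face of `Newt(h)` is not a vertex) — satisfies `2^((log₂ n + c)^c) < L₊(NN_n · h) + L₊(h)`.**

So the open residual of 21181 is now: cheap, astronomically-high-degree torus weight vectors that avoid some nest-free
perfect matching AND tie at the top of the pinned rainbow direction.  HONEST FRAMING: by-name bookkeeping over landed engines;
no progress is claimed on that residual; `NNDivisionHard`, `NNNotVP`, VP ≠ VNP remain OPEN (NOT proved).
References: Jerrum–Snir 1982 §4.3 [JerrumSnir1982]; Jukna–Seiwert–Sergeev 2022 Thm 1 [JuknaSeiwertSergeev2022];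
Hrubeš–Yehudayoff 2021 §6 Problem 2 [HrubesYehudayoff2021].
-/

noncomputable section

-- Sub = Summit single-conjunct layout: the duplicated namespace component is mandated by the tree.
set_option linter.dupNamespace false
set_option autoImplicit false

namespace Summit.ValiantsHypothesis.ValiantsHypothesis.Theorems.FifoMatching.NNDivisionHard.NonGenericResidual

open Finset MvPolynomial Literature.Computability.AlgebraicComplexity
open Summit.ValiantsHypothesis.ValiantsHypothesis.Theorems.FifoMatching.NNLowDegreeCofactorHard (vertexDeg)
open Summit.ValiantsHypothesis.ValiantsHypothesis.Theorems.FifoMatching.NNDivisionHard.UnsaturatedTier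
  (nnDivisionHard_iff_unsaturatedTier)
open Summit.ValiantsHypothesis.ValiantsHypothesis.Theorems.FifoMatching.NNDivisionHard.StackPowersQueue
  (prWeight generic_not_certificate_qp)
open scoped NNReal BigOperators

/-- ★ **`NNDivisionHard` ⟺ its cheap, torus-homogeneous, hyper-degree, unsaturated, NON-GENERIC tier** (the residual of
record after «stack powers do not help the queue»). [cite: JerrumSnir1982, §4.3] [cite: JuknaSeiwertSergeev2022, Thm 1]
[cite: HrubesYehudayoff2021, §6 Problem 2] -/
theorem nnDivisionHard_iff_unsaturatedNonGenericTier :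
    Summit.ValiantsHypothesis.ValiantsHypothesis.Theses.FifoMatching.NNDivisionHard ↔
    ∀ c : ℕ, ∃ n₀ : ℕ, ∀ n ≥ n₀, ∀ h : MvPolynomial (Fin (2 * n) × Fin (2 * n)) ℝ≥0, h ≠ 0 →
      (∀ d ∈ h.support, ∀ d' ∈ h.support, vertexDeg d = vertexDeg d') →
      2 ^ Nat.sqrt (Nat.sqrt (Nat.sqrt n)) < h.totalDegree →
      complexity h ≤ 2 ^ ((Nat.log 2 n + c) ^ c) →
      (∃ P ∈ nestFreeMatchings (2 * n), ∀ e ∈ h.support, ∃ a, e a ≠ 0 ∧ arcExponent P a = 0) →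
      (∀ e ∈ h.support, ∃ e' ∈ h.support, e' ≠ e ∧
        Finsupp.weight (prWeight n ((n + 2) / 3)) e ≤ Finsupp.weight (prWeight n ((n + 2) / 3)) e') →
        2 ^ ((Nat.log 2 n + c) ^ c) < complexity (nestFreeMatchingPoly n ℝ≥0 * h) + complexity h := by
  rw [nnDivisionHard_iff_unsaturatedTier]
  constructor
  · intro H c
    obtain ⟨n₀, hn₀⟩ := H c
    exact ⟨n₀, fun n hn h hh hhom hdeg hcost hunsat _ => hn₀ n hn h hh hhom hdeg hcost hunsat⟩
  · intro H c
    obtain ⟨n₀, hn₀⟩ := H c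
    obtain ⟨n₁, hn₁⟩ := generic_not_certificate_qp c
    refine ⟨max n₀ n₁, fun n hn h hh hhom hdeg hcost hunsat => ?_⟩
    by_cases hgen : ∃ e ∈ h.support, ∀ e' ∈ h.support, e' ≠ e →
        Finsupp.weight (prWeight n ((n + 2) / 3)) e' < Finsupp.weight (prWeight n ((n + 2) / 3)) e
    · obtain ⟨e, he, hg⟩ := hgen
      exact hn₁ n (le_trans (le_max_right _ _) hn) h e he hg
    · push Not at hgen
      exact hn₀ n (le_trans (le_max_left _ _) hn) h hh hhom hdeg hcost hunsat hgen

end Summit.ValiantsHypothesis.ValiantsHypothesis.Theorems.FifoMatching.NNDivisionHard.NonGenericResidual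

end
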